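import Mathlib
import Summits.ResolutionOfSingularities.ResolutionOfSingularities.Theorems.RadicialJungCleanModelsCleanProp44VertexInsertion
import HarnessLib

/-!
# Route `RadicialJung`, crux `CleanModels` (stmt-ResolutionOfSingularities-15917), line `Sketch` rev 35, stub 6 `stub_cleanProp44` (X44c):
# NEAR LINES WITH ARBITRARY EXPONENTS — only corners and births obstruct (the stages AFTER an insertion)

Seat decomp-res-hand-2 g19 (structural hand).  ✓ `cleanPermissibleAt_nearLine_or_corner_or_birth` (hand-2 g18, `…CleanProp44NearLineFinal.lean`) asks the
exponents of the clean monomial at the blown-up point `x` to be `0` or prime to `p`.  After an INSERTION (✓ `…CleanProp44VertexInsertion.lean`,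
✓ `…CleanProp44CrossInsertion.lean`) the next point `x'` carries the raw monomial `U · ε^{a_{i₀}} · E^{Σ a}` whose exponents may be NON-ZERO MULTIPLES OF
`p`, and the near lines of the NEW exceptional divisor `E_{x'}` must be analysed from THAT presentation (re-normalising through `CleanRegAt` would forget
which side is the old exceptional divisor).  Here is g18's theorem with arbitrary exponents, from ✓ `cleanPermissibleAt_exceptionalCurve_or_obstruction_of_sides_general`
and g18's no-tangency ✓ `side_trichotomy_nearLine_of_isBlowup`:

* `cleanPermissibleAt_nearLine_or_corner_or_birth_general` — `τ : X' → X` a blowing up with `J_x = 𝔪_x = (c₀, …, c_{n-1})` at `x = τ x'` (a regular system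
  of parameters), the line of `G` presented at `x` by `u · ∏ c_k^{a_k}` with ARBITRARY `a`, `dim 𝒪_{X',x'} = 3`, `N = (e', y')` the near line of a regular
  parameter `t_{j₀}` through `x'`.  Then: CLEAN-PERMISSIBLE ∨ CORNER (two sides `c_{k₁} ≠ c_{k₂}` with `p ∤ a_{k_j}` through `x'`, `(e', s₁, s₂) = 𝔪_{x'}`, `N` not
  an axis) ∨ BIRTH (`p ∣ Σ a`, no side with `p ∤ a_k` through `x'`, transform `U · e'^{Σ a} · D^p` with `U` failing the non-birth test).  No tangency.

Honest framing: OURS, bookkeeping; a TOOL for the (R1ᵐⁱⁿ)/(R3ᵐⁱⁿ′) provers.  Nothing here proves X44c, any case of `CleanModels`, or resolution of singularities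
in characteristic `p`.  Setting only: [cite: CossartPiltant2008, Lemma 4.3 (5); Prop. 4.4 (proof, p. 11)] [cite: Piltant2013, §2 Axiom 4]
[cite: GortzWedhorn2020, Prop. 13.91].
-/

noncomputable section

set_option linter.dupNamespace false -- mandated namespace of this single-conjunct summit

open IsLocalRing CategoryTheory AlgebraicGeometry
open Literature.AlgebraicGeometry.Resolution Literature.AlgebraicGeometry.Motives

namespace Summit.ResolutionOfSingularities.ResolutionOfSingularities.Theorems.RadicialJung.CleanModels

universe u

section Scheme

variable {p : ℕ} {X X' : Scheme.{u}} [IsIntegral X] [IsIntegral X'] {τ : X' ⟶ X} [IsDominant τ] {J : X.IdealSheafData}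

set_option maxHeartbeats 1600000 in
-- long statement; the proof is a translation plus g18's no-tangency
/-- **On a near line only corners and births obstruct — arbitrary exponents.**  See the module docstring.
[cite: CossartPiltant2008, Lemma 4.3 (5); Prop. 4.4 (proof, p. 11)] [cite: Piltant2013, §2 Axiom 4] -/
theorem cleanPermissibleAt_nearLine_or_corner_or_birth_general [Fact p.Prime] [CharP X'.functionField p] (hτ : IsBlowup τ J) (x' : X')
    (hR : IsRegularLocalRing (X.presheaf.stalk (τ x'))) {n : ℕ} (c : Fin n → X.presheaf.stalk (τ x'))
    (hc : Ideal.span (Set.range c) = maximalIdeal (X.presheaf.stalk (τ x')))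
    (hdim : ringKrullDim (X.presheaf.stalk (τ x')) = (n : WithBot ℕ∞)) (hJ : stalkIdeal J (τ x') = maximalIdeal (X.presheaf.stalk (τ x')))
    {G : X.functionField} {cc : Fin p → X.functionField} (hcc : ∃ j : Fin p, (j : ℕ) ≠ 0 ∧ cc j ≠ 0)
    {u : X.presheaf.stalk (τ x')} (hu : IsUnit u) (a : Fin n → ℕ)
    (hrep : (∑ j : Fin p, cc j ^ p * G ^ (j : ℕ)) = RatFn.toFunctionField (τ x') (u * ∏ k, c k ^ a k))
    (hdim' : ringKrullDim (X'.presheaf.stalk x') = 3)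
    {d : ℕ} (t : Fin d → X.presheaf.stalk (τ x')) (hspan : Ideal.span (Set.range t) = maximalIdeal (X.presheaf.stalk (τ x')))
    (hdimd : ringKrullDim (X.presheaf.stalk (τ x')) = (d : WithBot ℕ∞)) (j₀ : Fin d) {e' y' z' : X'.presheaf.stalk x'}
    (he' : Ideal.span {e'} = (maximalIdeal (X.presheaf.stalk (τ x'))).map (τ.stalkMap x').hom)
    (hy' : (τ.stalkMap x').hom (t j₀) = e' * y') (hy'm : y' ∈ maximalIdeal (X'.presheaf.stalk x'))
    (hzz : Ideal.span ({e', y', z'} : Set (X'.presheaf.stalk x')) = maximalIdeal (X'.presheaf.stalk x')) :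
    CleanPermissibleAt p (RatFn.toFunctionField x') (RatFn.functionFieldMap τ G) (Ideal.span ({e', y'} : Set (X'.presheaf.stalk x'))) ∨
    (∃ (k₁ k₂ : Fin n) (s₁ s₂ : X'.presheaf.stalk x'), k₁ ≠ k₂ ∧ ¬ p ∣ a k₁ ∧ ¬ p ∣ a k₂ ∧
        (τ.stalkMap x').hom (c k₁) = e' * s₁ ∧ (τ.stalkMap x').hom (c k₂) = e' * s₂ ∧
        Ideal.span ({e', s₁, s₂} : Set (X'.presheaf.stalk x')) = maximalIdeal (X'.presheaf.stalk x') ∧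
        s₁ ∉ Ideal.span ({e', y'} : Set (X'.presheaf.stalk x')) ∧ s₂ ∉ Ideal.span ({e', y'} : Set (X'.presheaf.stalk x'))) ∨
    (p ∣ ∑ k, a k ∧
      (∀ k, ¬ p ∣ a k → Ideal.span {(τ.stalkMap x').hom (c k)} = (maximalIdeal (X.presheaf.stalk (τ x'))).map (τ.stalkMap x').hom) ∧
      ∃ U D : X'.presheaf.stalk x', IsUnit U ∧ D ≠ 0 ∧
        (∑ j : Fin p, RatFn.functionFieldMap τ (cc j) ^ p * RatFn.functionFieldMap τ G ^ (j : ℕ)) =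
          RatFn.toFunctionField x' (U * e' ^ (∑ k, a k) * D ^ p) ∧
        ¬ ((∀ c' : X'.presheaf.stalk x', U - c' ^ p ∉ maximalIdeal (X'.presheaf.stalk x')) ∨
          (∃ c' : X'.presheaf.stalk x', U - c' ^ p ∈ maximalIdeal (X'.presheaf.stalk x') ∧
            U - c' ^ p ∉ Ideal.span ({e', y'} : Set (X'.presheaf.stalk x')) ⊔ maximalIdeal (X'.presheaf.stalk x') ^ 2) ∨
          (∃ c' : X'.presheaf.stalk x', U - c' ^ p ∈ Ideal.span ({e', y'} : Set (X'.presheaf.stalk x')) ∧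
            U - c' ^ p ∉ maximalIdeal (X'.presheaf.stalk x') ^ 2))) := by
  classical
  -- the form-(1) currency with `w = ∅`
  have hz0 : Ideal.span (Set.range (Fin.append c Fin.elim0)) = maximalIdeal (X.presheaf.stalk (τ x')) := by
    rw [span_range_append_elim0_eq, hc]
  have hdim0 : ringKrullDim (X.presheaf.stalk (τ x')) = ((n + 0 : ℕ) : WithBot ℕ∞) := by rw [Nat.add_zero]; exact hdim
  have hcJ : Ideal.span (Set.range c) = stalkIdeal J (τ x') := hc.trans hJ.symm
  have hrep0 : (∑ j : Fin p, cc j ^ p * G ^ (j : ℕ)) =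
      RatFn.toFunctionField (τ x') (u * (∏ k, c k ^ a k) * ∏ m' : Fin 0, (Fin.elim0 m' : X.presheaf.stalk (τ x')) ^ (Fin.elim0 m' : ℕ)) := by
    rw [hrep, Fin.prod_univ_zero, mul_one]
  have he'J : Ideal.span {e'} = (stalkIdeal J (τ x')).map (τ.stalkMap x').hom := by rw [hJ]; exact he'
  have hcm : ∀ k, c k ∈ maximalIdeal (X.presheaf.stalk (τ x')) := fun k => hc ▸ Ideal.subset_span ⟨k, rfl⟩
  -- `𝒪_{X',x'}` is regular of dimension `3`; `e' ≠ 0`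
  obtain ⟨_, _, _, _, -, -, -, -, -, hrsop, -⟩ :=
    exists_transform_normalForm_of_isBlowup hτ x' hR c Fin.elim0 hz0 hdim0 hcJ a Fin.elim0 hu
  have hR' : IsRegularLocalRing (X'.presheaf.stalk x') := hrsop.isRegularLocalRing
  haveI := isDomain_of_isRegularLocalRing (X'.presheaf.stalk x')
  have he'0 : e' ≠ 0 := by simpa using (isRsopPart_vecCons_three_of_span_triple hR' hdim' hzz).ne_zero 0
  -- no tangency on a near line (g18)
  have hnotan : ∀ {k : Fin n} {s : X'.presheaf.stalk x'}, (τ.stalkMap x').hom (c k) = e' * s → s ∈ maximalIdeal (X'.presheaf.stalk x') →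
      s ∉ Ideal.span ({e', y'} : Set (X'.presheaf.stalk x')) →
      s ∉ Ideal.span ({e', y'} : Set (X'.presheaf.stalk x')) ⊔ maximalIdeal (X'.presheaf.stalk x') ^ 2 := by
    intro k s hs hsm hsN hsN2
    obtain ⟨s', hs', htri⟩ := side_trichotomy_nearLine_of_isBlowup hτ x' hR t hspan hdimd hJ j₀ he' hy' hy'm hzz (hcm k)
    have hss : s' = s := mul_left_cancel₀ he'0 (hs'.symm.trans hs)
    subst hss
    rcases htri with hunit | htr | hmem
    · exact mem_nonunits_iff.mp ((mem_maximalIdeal _).mp hsm) hunit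
    · exact not_mem_span_pair_sup_sq_of_span_triple hR' hdim' htr hsN2
    · exact hsN hmem
  rcases cleanPermissibleAt_exceptionalCurve_or_obstruction_of_sides_general hτ x' hR c Fin.elim0 hz0 hdim0 hcJ hcc hu hrep0 hdim' he'J hzz with
    h | ⟨s₁, s₂, hne, hd₁, hd₂, hss, hs₁N, hs₂N⟩ | ⟨s, hds, hsm, hsN, hsN2⟩ | ⟨hA, hsides, -, U, D, hU, hD, hrepU, hnb⟩
  · exact Or.inl h
  · -- CORNER: both sides are `c`-sides (there is no `w`)
    right; left
    rcases hd₁ with ⟨k₁, hk₁, hs₁⟩ | ⟨m, -, -⟩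
    swap; · exact m.elim0
    rcases hd₂ with ⟨k₂, hk₂, hs₂⟩ | ⟨m, -, -⟩
    swap; · exact m.elim0
    refine ⟨k₁, k₂, s₁, s₂, ?_, hk₁, hk₂, hs₁, hs₂, hss, hs₁N, hs₂N⟩
    rintro rfl
    exact hne (mul_left_cancel₀ he'0 (hs₁.symm.trans hs₂))
  · -- TANGENT: void on a near line
    exfalso
    rcases hds with ⟨k, -, hs⟩ | ⟨m, -, -⟩
    · exact hnotan hs hsm hsN hsN2
    · exact m.elim0
  · -- BIRTH
    right; right
    refine ⟨hA, fun k hk => ?_, U, D, hU, hD, hrepU, hnb⟩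
    rw [hsides k hk, hJ]

end Scheme

end Summit.ResolutionOfSingularities.ResolutionOfSingularities.Theorems.RadicialJung.CleanModels

end
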